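import Summits.MatrixMultiplication.MatrixMultiplication.Theorems.SaturationLadderModulusLadder
import Summits.MatrixMultiplication.MatrixMultiplication.Theorems.FarEdgeDescentTowerDynamics
import HarnessLib

/-!
# Route `SaturationLadder` on Strassen's spectrum, VII: the CUSP — where the deciding crux lives

decomp-mm lens 1 «grading / quantitative ladder», gen 45, kernel K45-C (chain file 7 after `SaturationLadderThinRoof`,
`…CornerGerm`, `…CornerModulus`, `…FaceModulus`, `…PowerModulus`, `…ModulusLadder`).  Def-free, sorry-free support
beneath the deciding crux `SubexpSaturation` (stmt-MatrixMultiplication-25909) of `route-MatrixMultiplication-SaturationLadder`;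
cut of record UNCHANGED (`closes (h₁ : SubexpSaturation) (h₂ : SubexpToPoly) (h₃ : PolyToFinite) (h₄ : TailDescentTwo)
(h₅ : SquareFromTwo)`).  Notation: universal spectral point `φ`, `θ = specMMPoint K φ ∈ [0,1]³`, DARKNESS
`d = θ₀+θ₁+θ₂−2`, HEIGHT `θ₁`, DEPTH `ε₂ = 1−θ₂`, `u = log(θ₁/ε₂)`.  File 3 typed the crux as ONE number
(`SubexpSaturation ⟺ ∀κ>0: d·u ≤ κ·θ₁` beyond some `u₀(κ)`, over `ℂ`) and proved the law for `κ > c₂ = 1.0650…`.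
This file GRADES THE LAW BY REGION; second coordinate = the DEPTH EXPONENT `δ` of the cusp `{ε₂ ≤ θ₁^{1+δ}}` at the
corner `(1,0,1)` (equivalently `u ≥ δ·log(1/θ₁)`).
* §1 real lemmas: with `ε = θe^{−u}`, `B·ε^α·u ≤ 2B/(α²u)` (`θ ≤ 1`), and `B·ε^α·u ≤ κθ` inside the cusp `ε ≤ θ^{1+δ}`
  once `α(1+δ) > 1` and `θ ≤ θ⋆ = (κη/B)^{2/γ}` (`γ = α(1+δ)−1`, `η = γ/(2δ)`).
* §2 ★★ `cuspModulus_of_holderFace` (every field): a Hölder face law `d ≤ B·ε₂^α` (`0 < α ≤ 1`) gives, for every `δ`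
  with `α(1+δ) > 1` and EVERY `κ > 0`, a `u₀` with `d·u ≤ κθ₁` on the cusp `ε₂ ≤ θ₁^{1+δ}` beyond `u₀`;
  `highModulus_of_holderFace`: the same at every point of height `θ₁ ≥ η > 0`.
* §3 `cuspModulus_of_farRate_nat` (a far rate `e(k) ≤ C·k^{−ρ}` clears every cusp with `ρδ > 1`, Legendre
  `α = ρ/(1+ρ)`, file 4); `cuspModulus_two_sevenths` (`δ > 5/2`); ★ `cuspModulus_towerOrder` (every field, every
  `δ ≥ 50/21`, every `κ`, from route `FarEdgeDescent`'s landed `RateBeyond (21/50)`, kernel XXX-B3).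
* §4 ★★★ `subexpSaturation_iff_shallowCusp` (over `ℂ`; any `δ₀ ≥ 50/21`): **`SubexpSaturation ⟺ ∀κ>0 ∃η>0 ∃u₀ ∀φ:
  θ₂<1, u ≥ u₀, θ₁ < η, ε₂ > θ₁^{1+δ₀} ⟹ d·u ≤ κθ₁`** — ALL open content of the deciding crux sits in the SHALLOW CUSP
  GERM `{θ₁ < η, θ₁e^{−u₀} ≥ ε₂ > θ₁^{1+δ₀}}`; high points and deep cusps are theorems.  ★★ `phaseDiagram` (over `ℂ`):
  the law on the cusp of exponent `δ` is PROVED whenever `κ > c₂` (file 3) OR `δ ≥ 50/21` (any `κ > 0`) — an L-shaped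
  proved region of the `(κ, δ)` quarter-plane; the open rectangle is `(0, c₂] × [0, 50/21)`, the crux its corner at `δ = 0`.
* §5 the dial: `cuspModulus_of_rateBeyond` (`RateBeyond θ`, `θ > 0`, clears every cusp `δ ≥ 1/θ`) and
  `allCusps_of_allRates` (every power rate ⟹ every cusp `δ > 0`, nothing at `δ = 0`): the face/rate programme shrinks
  the open rectangle from the `δ` side down to, never including, the shallow edge; the certificate programme (files
  2–3, class floor `c⋆ = 1.0645958`) shrinks it from the `κ` side.
Nothing here proves `ω = 2` or an open item; no definitions (gate rule D-0009).  [cite: Strassen1988, Thm. 3.8]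
[cite: LottiRomani1983, Prop. 4.1] [cite: CoppersmithWinograd1990, §8] [cite: AlmanLi2026, Proposition 4.2]
[cite: Pan1984, Thm. 17.1] [cite: AlmanDuanVassilevskaWilliamsXuXuZhou2025, §3.4]
-/

set_option linter.dupNamespace false

noncomputable section

namespace Summit.MatrixMultiplication.MatrixMultiplication.Theorems.SaturationLadderCuspModulus

open Literature.Computability.AlgebraicComplexity
open Summit.MatrixMultiplication.MatrixMultiplication.Theses.SaturationLadder
open Summit.MatrixMultiplication.MatrixMultiplication.Theorems.SaturationLadderCornerModulus
open Summit.MatrixMultiplication.MatrixMultiplication.Theorems.SaturationLadderFaceModulus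
open Summit.MatrixMultiplication.MatrixMultiplication.Theorems.SaturationLadderModulusLadder
open Summit.MatrixMultiplication.MatrixMultiplication.Theorems.FarEdgeDescentTowerDynamics
  (rateBeyond_of_le_twentyOne_fiftieths)

variable {K : Type} [Field K]

/-! ## §1 Two real-variable lemmas -/

/-- **High/anywhere bound**: for `θ ∈ (0,1]`, `ε > 0`, `u = log(θ/ε) > 0` (so `ε = θe^{−u}`) and `B, α > 0`,
`B·ε^α·u ≤ 2B/(α²·u)` — `ε^α ≤ e^{−αu}` and `u·e^{−αu} ≤ 2/(α²u)` (`e^x ≥ x²/2`). [folklore] -/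
theorem holder_high_bound {B α θ ε u : ℝ} (hB : 0 < B) (hα : 0 < α) (hθ : 0 < θ) (hθ1 : θ ≤ 1)
    (hε : 0 < ε) (hu : u = Real.log (θ / ε)) (hu0 : 0 < u) :
    B * ε ^ α * u ≤ 2 * B / (α ^ 2 * u) := by
  have hexpu : Real.exp u = θ / ε := by rw [hu, Real.exp_log (div_pos hθ hε)]
  have hεu : ε = θ * Real.exp (-u) := by rw [Real.exp_neg, hexpu]; field_simp
  have hE : 0 < Real.exp (-u) := Real.exp_pos _
  have hεα : ε ^ α = θ ^ α * Real.exp (-u) ^ α := by rw [hεu, Real.mul_rpow hθ.le hE.le]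
  have hθα : θ ^ α ≤ 1 := Real.rpow_le_one hθ.le hθ1 hα.le
  have hEα : Real.exp (-u) ^ α = Real.exp (-(α * u)) := by rw [← Real.exp_mul]; ring_nf
  have h1 : ε ^ α ≤ Real.exp (-(α * u)) := by
    rw [hεα, hEα]; simpa using mul_le_mul_of_nonneg_right hθα (Real.exp_pos (-(α * u))).le
  have hpow : (α * u) ^ 2 / 2 ≤ Real.exp (α * u) := by
    have := Real.pow_div_factorial_le_exp (x := α * u) (hx := by positivity) (n := 2)
    simpa [Nat.factorial] using this
  have hEpos : 0 < Real.exp (α * u) := Real.exp_pos _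
  have hux : u * Real.exp (-(α * u)) ≤ 2 / (α ^ 2 * u) := by
    rw [Real.exp_neg, ← div_eq_mul_inv, div_le_div_iff₀ hEpos (by positivity)]
    nlinarith
  calc B * ε ^ α * u ≤ B * Real.exp (-(α * u)) * u :=
        mul_le_mul_of_nonneg_right (mul_le_mul_of_nonneg_left h1 hB.le) hu0.le
    _ = B * (u * Real.exp (-(α * u))) := by ring
    _ ≤ B * (2 / (α ^ 2 * u)) := mul_le_mul_of_nonneg_left hux hB.le
    _ = 2 * B / (α ^ 2 * u) := by ring

/-- **Cusp bound**: for `θ, ε > 0`, `u = log(θ/ε) > 0`, `B, κ > 0`, `0 < α ≤ 1` and a cusp exponent `δ` with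
`α(1+δ) > 1`: if `ε ≤ θ^{1+δ}` and `θ ≤ θ⋆ := (κη/B)^{2/γ}` (`γ = α(1+δ)−1 > 0`, `η = γ/(2δ) ≤ α/2`), then
`B·ε^α·u ≤ κ·θ`.  Proof: `e^{−u} = ε/θ ≤ θ^δ`; `ε^α = θ^α·e^{−(α−η)u}·e^{−ηu}`, `u·e^{−ηu} ≤ 1/η`,
`e^{−(α−η)u} ≤ θ^{δ(α−η)}`, and `α + δ(α−η) = 1 + γ/2`, so `B·ε^α·u ≤ (B/η)·θ·θ^{γ/2} ≤ (B/η)·θ·(κη/B) = κθ`.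
[folklore] -/
theorem holder_cusp_bound {B α δ κ θ ε u : ℝ} (hB : 0 < B) (hα : 0 < α) (hα1 : α ≤ 1)
    (hδ : 1 < α * (1 + δ)) (hκ : 0 < κ) (hθ : 0 < θ) (hε : 0 < ε)
    (hcusp : ε ≤ θ ^ (1 + δ)) (hu : u = Real.log (θ / ε)) (hu0 : 0 < u)
    (hsmall : θ ≤ (κ * ((α * (1 + δ) - 1) / (2 * δ)) / B) ^ (2 / (α * (1 + δ) - 1))) :
    B * ε ^ α * u ≤ κ * θ := by
  set γ : ℝ := α * (1 + δ) - 1 with hγdef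
  have hγ : 0 < γ := by rw [hγdef]; linarith
  have hδ0 : 0 < δ := by nlinarith
  set η : ℝ := γ / (2 * δ) with hηdef
  have hη : 0 < η := by positivity
  have hηα : η ≤ α / 2 := by
    rw [hηdef, div_le_div_iff₀ (by positivity) two_pos, hγdef]
    nlinarith
  have hαη : 0 < α - η := by linarith
  set m : ℝ := κ * η / B with hmdef
  have hm : 0 < m := by positivity
  have hexpu : Real.exp u = θ / ε := by rw [hu, Real.exp_log (div_pos hθ hε)]
  set E : ℝ := Real.exp (-u) with hEdef
  have hE : 0 < E := Real.exp_pos _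
  have hεu : ε = θ * E := by rw [hEdef, Real.exp_neg, hexpu]; field_simp
  -- cusp: `E ≤ θ^δ`
  have hEδ : E ≤ θ ^ δ := by
    have h1 : θ * E ≤ θ * θ ^ δ := by
      rw [← hεu, ← Real.rpow_one_add' hθ.le (by linarith : 1 + δ ≠ 0)]
      exact hcusp
    exact le_of_mul_le_mul_left h1 hθ
  -- `u E^η ≤ 1/η`
  have hEη : E ^ η = Real.exp (-(η * u)) := by rw [hEdef, ← Real.exp_mul]; ring_nf
  have huE : u * E ^ η ≤ 1 / η := by
    rw [hEη, Real.exp_neg, ← div_eq_mul_inv, div_le_div_iff₀ (Real.exp_pos _) hη, one_mul]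
    have := Real.add_one_le_exp (η * u)
    nlinarith
  -- `E^{α-η} ≤ θ^{δ(α-η)}`
  have hEαη : E ^ (α - η) ≤ θ ^ (δ * (α - η)) := by
    rw [Real.rpow_mul hθ.le]
    exact Real.rpow_le_rpow hE.le hEδ hαη.le
  have hεα : ε ^ α = θ ^ α * (E ^ (α - η) * E ^ η) := by
    rw [hεu, Real.mul_rpow hθ.le hE.le, ← Real.rpow_add hE]; ring_nf
  -- exponent bookkeeping: `α + δ(α-η) = 1 + γ/2`
  have hexp_id : α + δ * (α - η) = 1 + γ / 2 := by
    rw [hηdef, hγdef]; field_simp; ring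
  have hθpow : θ ^ α * θ ^ (δ * (α - η)) = θ * θ ^ (γ / 2) := by
    rw [← Real.rpow_add hθ, hexp_id, Real.rpow_add hθ, Real.rpow_one]
  -- smallness: `θ^{γ/2} ≤ m`
  have hθγ : θ ^ (γ / 2) ≤ m := by
    have h1 : θ ^ (γ / 2) ≤ (m ^ (2 / γ)) ^ (γ / 2) :=
      Real.rpow_le_rpow hθ.le hsmall (by positivity)
    rw [← Real.rpow_mul hm.le] at h1
    have e : 2 / γ * (γ / 2) = 1 := by field_simp
    rwa [e, Real.rpow_one] at h1
  calc B * ε ^ α * u = B * θ ^ α * E ^ (α - η) * (u * E ^ η) := by rw [hεα]; ring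
    _ ≤ B * θ ^ α * θ ^ (δ * (α - η)) * (1 / η) := by
        apply mul_le_mul _ huE (by positivity) (by positivity)
        exact mul_le_mul_of_nonneg_left hEαη (by positivity)
    _ = B / η * (θ * θ ^ (γ / 2)) := by rw [← hθpow]; ring
    _ ≤ B / η * (θ * m) := by
        apply mul_le_mul_of_nonneg_left _ (by positivity)
        exact mul_le_mul_of_nonneg_left hθγ hθ.le
    _ = κ * θ := by rw [hmdef]; field_simp

/-! ## §2 The cusp law and the high-point law from a Hölder face law (every field) -/

/-- ★★ **HÖLDER FACE LAW ⟹ CORNER MODULUS ON EVERY DEEP CUSP, AT EVERY SCALE** (every field): if every universal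
spectral point obeys `θ₀+θ₁+θ₂−2 ≤ B·(1−θ₂)^α` (`B > 0`, `0 < α ≤ 1`), then for every cusp exponent `δ` with
`α(1+δ) > 1` and every `κ > 0` there is `u₀` such that every universal spectral point off the face with
`u = log(θ₁/(1−θ₂)) ≥ u₀` INSIDE THE CUSP `1−θ₂ ≤ θ₁^{1+δ}` satisfies `(θ₀+θ₁+θ₂−2)·u ≤ κ·θ₁`.  Threshold
`u₀ = max 1 (2B/(α²κθ⋆))`, `θ⋆` as in `holder_cusp_bound` (low points by the cusp bound, high points by the anywhere
bound). [cite: Strassen1988, Thm. 3.8] [cite: AlmanLi2026, Proposition 4.2] -/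
theorem cuspModulus_of_holderFace {B α : ℝ} (hB : 0 < B) (hα : 0 < α) (hα1 : α ≤ 1)
    (h : ∀ F : SpectralMap K, IsUniversalSpectralPoint K F →
      specMMPoint K F 0 + specMMPoint K F 1 + specMMPoint K F 2 - 2 ≤ B * (1 - specMMPoint K F 2) ^ α)
    {δ : ℝ} (hδ : 1 < α * (1 + δ)) {κ : ℝ} (hκ : 0 < κ) :
    ∃ u₀ : ℝ, ∀ F : SpectralMap K, IsUniversalSpectralPoint K F → specMMPoint K F 2 < 1 →
      u₀ ≤ Real.log (specMMPoint K F 1 / (1 - specMMPoint K F 2)) →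
        1 - specMMPoint K F 2 ≤ specMMPoint K F 1 ^ (1 + δ) →
          (specMMPoint K F 0 + specMMPoint K F 1 + specMMPoint K F 2 - 2) *
              Real.log (specMMPoint K F 1 / (1 - specMMPoint K F 2)) ≤ κ * specMMPoint K F 1 := by
  have hγ : 0 < α * (1 + δ) - 1 := by linarith
  have hδ0 : 0 < δ := by nlinarith
  set θs : ℝ := (κ * ((α * (1 + δ) - 1) / (2 * δ)) / B) ^ (2 / (α * (1 + δ) - 1)) with hθsdef
  have hθs : 0 < θs := Real.rpow_pos_of_pos (by positivity) _
  refine ⟨max 1 (2 * B / (α ^ 2 * κ * θs)), fun F hF h2 hu hcusp => ?_⟩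
  set θ₀ := specMMPoint K F 0 with hθ₀def
  set θ₁ := specMMPoint K F 1 with hθ₁def
  set θ₂ := specMMPoint K F 2 with hθ₂def
  have h1 := AlmanLi2026.prop42_mem_Icc hF 1
  rw [← hθ₁def] at h1
  have hε : 0 < 1 - θ₂ := by linarith
  have hu1 : 1 ≤ Real.log (θ₁ / (1 - θ₂)) := le_trans (le_max_left _ _) hu
  have huB : 2 * B / (α ^ 2 * κ * θs) ≤ Real.log (θ₁ / (1 - θ₂)) := le_trans (le_max_right _ _) hu
  -- `θ₁ > 0` (else the logarithm vanishes)
  have hθ1 : 0 < θ₁ := by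
    rcases h1.1.eq_or_lt with h0 | h0
    · exfalso
      have : Real.log (θ₁ / (1 - θ₂)) = 0 := by rw [← h0, zero_div, Real.log_zero]
      linarith
    · exact h0
  set u := Real.log (θ₁ / (1 - θ₂)) with hudef
  have hu0 : 0 < u := by linarith
  have hd : (θ₀ + θ₁ + θ₂ - 2) * u ≤ B * (1 - θ₂) ^ α * u := by
    have := h F hF
    rw [← hθ₀def, ← hθ₁def, ← hθ₂def] at this
    exact mul_le_mul_of_nonneg_right this hu0.le
  rcases le_or_gt θ₁ θs with hlow | hhigh
  · -- low point inside the cusp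
    exact hd.trans (holder_cusp_bound hB hα hα1 hδ hκ hθ1 hε hcusp hudef hu0 hlow)
  · -- high point: the anywhere bound
    have hA := holder_high_bound hB hα hθ1 h1.2 hε hudef hu0
    have hκθ : 2 * B / (α ^ 2 * u) ≤ κ * θs := by
      rw [div_le_iff₀ (by positivity)]
      have := (div_le_iff₀ (by positivity : (0 : ℝ) < α ^ 2 * κ * θs)).1 huB
      nlinarith
    have : κ * θs ≤ κ * θ₁ := mul_le_mul_of_nonneg_left hhigh.le hκ.le
    linarith

/-- ★ **HÖLDER FACE LAW ⟹ CORNER MODULUS AT EVERY HIGH POINT, AT EVERY SCALE** (every field): under the same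
Hölder law, for every `η > 0` and `κ > 0`, every universal spectral point of height `θ₁ ≥ η` off the face with
`u ≥ max 1 (2B/(α²κη))` satisfies `(θ₀+θ₁+θ₂−2)·u ≤ κ·θ₁`.  (File 1's high-point law gave the thin CLAUSES at high
points over `ℂ`; this is the modulus form, every field.) [cite: Strassen1988, Thm. 3.8] [cite: AlmanLi2026, Proposition 4.2] -/
theorem highModulus_of_holderFace {B α : ℝ} (hB : 0 < B) (hα : 0 < α)
    (h : ∀ F : SpectralMap K, IsUniversalSpectralPoint K F →
      specMMPoint K F 0 + specMMPoint K F 1 + specMMPoint K F 2 - 2 ≤ B * (1 - specMMPoint K F 2) ^ α)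
    {η : ℝ} (hη : 0 < η) {κ : ℝ} (hκ : 0 < κ) :
    ∃ u₀ : ℝ, ∀ F : SpectralMap K, IsUniversalSpectralPoint K F → specMMPoint K F 2 < 1 →
      u₀ ≤ Real.log (specMMPoint K F 1 / (1 - specMMPoint K F 2)) → η ≤ specMMPoint K F 1 →
        (specMMPoint K F 0 + specMMPoint K F 1 + specMMPoint K F 2 - 2) *
            Real.log (specMMPoint K F 1 / (1 - specMMPoint K F 2)) ≤ κ * specMMPoint K F 1 := by
  refine ⟨max 1 (2 * B / (α ^ 2 * κ * η)), fun F hF h2 hu hη1 => ?_⟩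
  set θ₀ := specMMPoint K F 0 with hθ₀def
  set θ₁ := specMMPoint K F 1 with hθ₁def
  set θ₂ := specMMPoint K F 2 with hθ₂def
  have h1 := AlmanLi2026.prop42_mem_Icc hF 1
  rw [← hθ₁def] at h1
  have hε : 0 < 1 - θ₂ := by linarith
  have hθ1 : 0 < θ₁ := lt_of_lt_of_le hη hη1
  have hu1 : 1 ≤ Real.log (θ₁ / (1 - θ₂)) := le_trans (le_max_left _ _) hu
  have huB : 2 * B / (α ^ 2 * κ * η) ≤ Real.log (θ₁ / (1 - θ₂)) := le_trans (le_max_right _ _) hu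
  set u := Real.log (θ₁ / (1 - θ₂)) with hudef
  have hu0 : 0 < u := by linarith
  have hd : (θ₀ + θ₁ + θ₂ - 2) * u ≤ B * (1 - θ₂) ^ α * u := by
    have := h F hF
    rw [← hθ₀def, ← hθ₁def, ← hθ₂def] at this
    exact mul_le_mul_of_nonneg_right this hu0.le
  have hA := holder_high_bound hB hα hθ1 h1.2 hε hudef hu0
  have hκθ : 2 * B / (α ^ 2 * u) ≤ κ * η := by
    rw [div_le_iff₀ (by positivity)]
    have := (div_le_iff₀ (by positivity : (0 : ℝ) < α ^ 2 * κ * η)).1 huB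
    nlinarith
  have : κ * η ≤ κ * θ₁ := mul_le_mul_of_nonneg_left hη1 hκ.le
  linarith

/-! ## §3 Instances: far rates clear deep cusps -/

/-- ★ **A FAR RATE CLEARS EVERY CUSP BEYOND ITS RECIPROCAL** (every field): if `ω(1,k,1) − (k+1) ≤ C·k^{−ρ}` for
every integer `k ≥ 1` (`C, ρ > 0`), then for every cusp exponent `δ` with `ρ·δ > 1` and every `κ > 0` the corner
modulus law `d·u ≤ κθ₁` holds on the cusp `1−θ₂ ≤ θ₁^{1+δ}` beyond some `u₀` — file 4's Legendre exchange
`α = ρ/(1+ρ)` (`holderFace_of_farRate_nat`) and §2 (`α(1+δ) > 1 ⟺ ρδ > 1`).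
[cite: LottiRomani1983, Prop. 4.1] [cite: Strassen1988, Thm. 3.8] -/
theorem cuspModulus_of_farRate_nat {C ρ : ℝ} (hC : 0 < C) (hρ : 0 < ρ)
    (h : ∀ k : ℕ, 1 ≤ k → omegaRect K 1 k 1 - (k + 1) ≤ C * (k : ℝ) ^ (-ρ))
    {δ : ℝ} (hδ : 1 < ρ * δ) {κ : ℝ} (hκ : 0 < κ) :
    ∃ u₀ : ℝ, ∀ F : SpectralMap K, IsUniversalSpectralPoint K F → specMMPoint K F 2 < 1 →
      u₀ ≤ Real.log (specMMPoint K F 1 / (1 - specMMPoint K F 2)) →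
        1 - specMMPoint K F 2 ≤ specMMPoint K F 1 ^ (1 + δ) →
          (specMMPoint K F 0 + specMMPoint K F 1 + specMMPoint K F 2 - 2) *
              Real.log (specMMPoint K F 1 / (1 - specMMPoint K F 2)) ≤ κ * specMMPoint K F 1 := by
  have hH := fun F (hF : IsUniversalSpectralPoint K F) => holderFace_of_farRate_nat hC hρ h hF
  have h1ρ : 0 < 1 + ρ := by linarith
  refine cuspModulus_of_holderFace (by positivity) (div_pos hρ h1ρ)
    ((div_le_one h1ρ).2 (by linarith)) hH ?_ hκ
  -- `ρ/(1+ρ)·(1+δ) > 1 ⟺ ρδ > 1`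
  rw [div_mul_eq_mul_div, lt_div_iff₀ h1ρ]
  nlinarith

/-- ★ **The clean rung clears the cusps of exponent `> 5/2`** (every field): from file 4's `d ≤ 6·(1−θ₂)^{2/7}`,
`(2/7)(1+δ) > 1 ⟺ δ > 5/2`. [cite: LottiRomani1983, Prop. 4.1] [cite: CoppersmithWinograd1982, Thm. 1] -/
theorem cuspModulus_two_sevenths {δ : ℝ} (hδ : 5 / 2 < δ) {κ : ℝ} (hκ : 0 < κ) :
    ∃ u₀ : ℝ, ∀ F : SpectralMap K, IsUniversalSpectralPoint K F → specMMPoint K F 2 < 1 →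
      u₀ ≤ Real.log (specMMPoint K F 1 / (1 - specMMPoint K F 2)) →
        1 - specMMPoint K F 2 ≤ specMMPoint K F 1 ^ (1 + δ) →
          (specMMPoint K F 0 + specMMPoint K F 1 + specMMPoint K F 2 - 2) *
              Real.log (specMMPoint K F 1 / (1 - specMMPoint K F 2)) ≤ κ * specMMPoint K F 1 :=
  cuspModulus_of_holderFace (K := K) (by norm_num : (0 : ℝ) < 6) (by norm_num : (0 : ℝ) < 2 / 7)
    (by norm_num) (fun _ hF => holderFace_two_sevenths hF) (by linarith) hκ

/-- ★★ **THE RATE RECORD CLEARS EVERY CUSP OF EXPONENT `≥ 50/21`** (every field): route `FarEdgeDescent`'s landed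
`RateBeyond (21/50)` (kernel XXX-B3: `∃ ρ > 21/50 ∃ C ∀ integer k ≥ 1, ω(1,k,1) − (k+1) ≤ C·k^{−ρ}`, tower order
`0.4269…`) gives, for every `δ ≥ 50/21` and every `κ > 0`, the corner modulus law `d·u ≤ κθ₁` on the cusp
`1−θ₂ ≤ θ₁^{1+δ}` beyond some `u₀` (`ρδ > (21/50)(50/21) = 1`). [cite: Pan1984, Thm. 17.1] [cite: LottiRomani1983, Prop. 4.1] -/
theorem cuspModulus_towerOrder {δ : ℝ} (hδ : 50 / 21 ≤ δ) {κ : ℝ} (hκ : 0 < κ) :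
    ∃ u₀ : ℝ, ∀ F : SpectralMap K, IsUniversalSpectralPoint K F → specMMPoint K F 2 < 1 →
      u₀ ≤ Real.log (specMMPoint K F 1 / (1 - specMMPoint K F 2)) →
        1 - specMMPoint K F 2 ≤ specMMPoint K F 1 ^ (1 + δ) →
          (specMMPoint K F 0 + specMMPoint K F 1 + specMMPoint K F 2 - 2) *
              Real.log (specMMPoint K F 1 / (1 - specMMPoint K F 2)) ≤ κ * specMMPoint K F 1 := by
  obtain ⟨ρ, C, hρ, hC⟩ := rateBeyond_of_le_twentyOne_fiftieths K (le_refl (21 / 50 : ℝ))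
  have hρ0 : 0 < ρ := by linarith
  -- make the constant positive
  have hC' : ∀ k : ℕ, 1 ≤ k → omegaRect K 1 k 1 - (k + 1) ≤ max C 1 * (k : ℝ) ^ (-ρ) := by
    intro k hk
    have hkpos : (0 : ℝ) < (k : ℝ) ^ (-ρ) := Real.rpow_pos_of_pos (by exact_mod_cast hk) _
    exact (hC k hk).trans (mul_le_mul_of_nonneg_right (le_max_left _ _) hkpos.le)
  refine cuspModulus_of_farRate_nat (lt_of_lt_of_le one_pos (le_max_right _ _)) hρ0 hC' ?_ hκ
  have hδ0 : 0 < δ := by linarith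
  calc (1 : ℝ) = 21 / 50 * (50 / 21) := by norm_num
    _ ≤ 21 / 50 * δ := by nlinarith
    _ < ρ * δ := by nlinarith

/-! ## §4 Localisation of the deciding crux and the phase diagram (over `ℂ`) -/

/-- ★★★ **THE CRUX LIVES IN THE SHALLOW CUSP GERM**: for any `δ₀ ≥ 50/21`, `SubexpSaturation ⟺` for every `κ > 0`
there are `η > 0` and `u₀` such that every universal spectral point over `ℂ` off the face with `u = log(θ₁/(1−θ₂)) ≥ u₀`,
SMALL height `θ₁ < η` and SHALLOW depth `1−θ₂ > θ₁^{1+δ₀}` satisfies `(θ₀+θ₁+θ₂−2)·u ≤ κθ₁`.  (⟹: file 3's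
`subexpSaturation_iff_modulus`, restricted.  ⟸: high points `θ₁ ≥ η` by `highModulus_of_holderFace` with the clean
rung `d ≤ 6ε₂^{2/7}`, deep points `1−θ₂ ≤ θ₁^{1+δ₀}` by `cuspModulus_towerOrder`, the rest by hypothesis.)  So the
open content of `h₁` is the regularity of darkness in the horn `{θ₁ < η, θ₁·e^{−u₀} ≥ 1−θ₂ > θ₁^{1+δ₀}}` at the
corner `(1,0,1)` — log-aspect `u` between `u₀` and `δ₀·log(1/θ₁)`. [cite: Strassen1988, Thm. 3.8]
[cite: CoppersmithWinograd1990, §8] [cite: Pan1984, Thm. 17.1] -/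
theorem subexpSaturation_iff_shallowCusp {δ₀ : ℝ} (hδ₀ : 50 / 21 ≤ δ₀) :
    SubexpSaturation ↔ ∀ κ : ℝ, 0 < κ → ∃ η u₀ : ℝ, 0 < η ∧ ∀ F : SpectralMap ℂ, IsUniversalSpectralPoint ℂ F →
      specMMPoint ℂ F 2 < 1 → u₀ ≤ Real.log (specMMPoint ℂ F 1 / (1 - specMMPoint ℂ F 2)) →
        specMMPoint ℂ F 1 < η → specMMPoint ℂ F 1 ^ (1 + δ₀) < 1 - specMMPoint ℂ F 2 →
          (specMMPoint ℂ F 0 + specMMPoint ℂ F 1 + specMMPoint ℂ F 2 - 2) *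
              Real.log (specMMPoint ℂ F 1 / (1 - specMMPoint ℂ F 2)) ≤ κ * specMMPoint ℂ F 1 := by
  rw [subexpSaturation_iff_modulus]
  constructor
  · intro h κ hκ
    obtain ⟨u₀, hu₀⟩ := h κ hκ
    exact ⟨1, u₀, one_pos, fun F hF h2 hu _ _ => hu₀ F hF h2 hu⟩
  · intro h κ hκ
    obtain ⟨η, u₁, hη, hS⟩ := h κ hκ
    obtain ⟨u₂, hH⟩ := highModulus_of_holderFace (K := ℂ) (by norm_num : (0 : ℝ) < 6)
      (by norm_num : (0 : ℝ) < 2 / 7) (fun _ hF => holderFace_two_sevenths hF) hη hκ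
    obtain ⟨u₃, hD⟩ := cuspModulus_towerOrder (K := ℂ) hδ₀ hκ
    refine ⟨max u₁ (max u₂ u₃), fun F hF h2 hu => ?_⟩
    have hu₁ : u₁ ≤ _ := le_trans (le_max_left _ _) hu
    have hu₂ : u₂ ≤ _ := le_trans (le_trans (le_max_left _ _) (le_max_right _ _)) hu
    have hu₃ : u₃ ≤ _ := le_trans (le_trans (le_max_right _ _) (le_max_right _ _)) hu
    rcases le_or_gt η (specMMPoint ℂ F 1) with hhigh | hlow
    · exact hH F hF h2 hu₂ hhigh
    rcases le_or_gt (1 - specMMPoint ℂ F 2) (specMMPoint ℂ F 1 ^ (1 + δ₀)) with hdeep | hshallow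
    · exact hD F hF h2 hu₃ hdeep
    · exact hS F hF h2 hu₁ hlow hshallow

/-- ★★ **THE `(κ, δ)` PHASE DIAGRAM** (over `ℂ`): the corner modulus law `(θ₀+θ₁+θ₂−2)·u ≤ κ·θ₁` on the cusp of
exponent `δ` (beyond some `u₀`; any real `δ`) is PROVED whenever `κ > c₂ = (5 log(5/4) + 3 log 2)/3` (file 3, the
Coppersmith–Winograd corner certificates; any `δ`) OR `δ ≥ 50/21` (§3, the far-rate record; any `κ > 0`).  The open
rectangle is `κ ∈ (0, c₂]`, `δ ∈ [0, 50/21)`; `SubexpSaturation` is its corner (`δ = 0`, every `κ > 0`).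
[cite: CoppersmithWinograd1990, §8] [cite: Pan1984, Thm. 17.1] [cite: Strassen1988, Thm. 3.8] -/
theorem phaseDiagram {κ δ : ℝ} (hκ : 0 < κ)
    (h : (5 * Real.log (5 / 4) + 3 * Real.log 2) / 3 < κ ∨ 50 / 21 ≤ δ) :
    ∃ u₀ : ℝ, ∀ F : SpectralMap ℂ, IsUniversalSpectralPoint ℂ F → specMMPoint ℂ F 2 < 1 →
      u₀ ≤ Real.log (specMMPoint ℂ F 1 / (1 - specMMPoint ℂ F 2)) →
        1 - specMMPoint ℂ F 2 ≤ specMMPoint ℂ F 1 ^ (1 + δ) →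
          (specMMPoint ℂ F 0 + specMMPoint ℂ F 1 + specMMPoint ℂ F 2 - 2) *
              Real.log (specMMPoint ℂ F 1 / (1 - specMMPoint ℂ F 2)) ≤ κ * specMMPoint ℂ F 1 := by
  rcases h with hκ₂ | hδ₂
  · obtain ⟨u₀, hu₀⟩ := modulus_above_classCeiling κ hκ₂
    exact ⟨u₀, fun F hF h2 hu _ => hu₀ F hF h2 hu⟩
  · exact cuspModulus_towerOrder hδ₂ hκ

/-! ## §5 The dial: what the rate programme does and does not clear -/

/-- ★ **`RateBeyond θ` clears every cusp of exponent `≥ 1/θ`** (every field, `θ > 0`): from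
`∃ ρ > θ ∃ C ∀ integer k ≥ 1, ω(1,k,1) − (k+1) ≤ C·k^{−ρ}` the corner modulus law holds at every `κ > 0` on every
cusp `1−θ₂ ≤ θ₁^{1+δ}` with `δ ≥ 1/θ` (`ρδ > θ·(1/θ) = 1`). [cite: LottiRomani1983, Prop. 4.1] -/
theorem cuspModulus_of_rateBeyond {θ : ℝ} (hθ : 0 < θ)
    (h : ∃ ρ C : ℝ, θ < ρ ∧ ∀ k : ℕ, 1 ≤ k → omegaRect K 1 k 1 - (k + 1) ≤ C * (k : ℝ) ^ (-ρ))
    {δ : ℝ} (hδ : 1 / θ ≤ δ) {κ : ℝ} (hκ : 0 < κ) :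
    ∃ u₀ : ℝ, ∀ F : SpectralMap K, IsUniversalSpectralPoint K F → specMMPoint K F 2 < 1 →
      u₀ ≤ Real.log (specMMPoint K F 1 / (1 - specMMPoint K F 2)) →
        1 - specMMPoint K F 2 ≤ specMMPoint K F 1 ^ (1 + δ) →
          (specMMPoint K F 0 + specMMPoint K F 1 + specMMPoint K F 2 - 2) *
              Real.log (specMMPoint K F 1 / (1 - specMMPoint K F 2)) ≤ κ * specMMPoint K F 1 := by
  obtain ⟨ρ, C, hρ, hC⟩ := h
  have hρ0 : 0 < ρ := lt_trans hθ hρ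
  have hC' : ∀ k : ℕ, 1 ≤ k → omegaRect K 1 k 1 - (k + 1) ≤ max C 1 * (k : ℝ) ^ (-ρ) := by
    intro k hk
    have hkpos : (0 : ℝ) < (k : ℝ) ^ (-ρ) := Real.rpow_pos_of_pos (by exact_mod_cast hk) _
    exact (hC k hk).trans (mul_le_mul_of_nonneg_right (le_max_left _ _) hkpos.le)
  refine cuspModulus_of_farRate_nat (lt_of_lt_of_le one_pos (le_max_right _ _)) hρ0 hC' ?_ hκ
  have h1 : 1 ≤ θ * δ := by
    have := mul_le_mul_of_nonneg_left hδ hθ.le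
    rwa [mul_one_div_cancel hθ.ne'] at this
  have hδ0 : 0 < δ := by
    have : 0 < 1 / θ := by positivity
    linarith
  nlinarith

/-- ★ **THE TOP OF THE RATE DIAL CLEARS EVERY CUSP OF POSITIVE EXPONENT — AND STOPS THERE** (every field): if
`RateBeyond θ` holds for every `θ ≥ 0` (every power rate at the far edge; the top of route `FarEdgeDescent`'s dial,
equivalently the Hölder face law at every exponent `α < 1`, file 6's `rateBeyond_iff_holderBeyond`), then for every
`δ > 0` and every `κ > 0` the corner modulus law holds on the cusp `1−θ₂ ≤ θ₁^{1+δ}` beyond some `u₀`.  The exponent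
`δ = 0` (the shallow cusp of §4, where `SubexpSaturation` lives) is NOT reached by any single rate: that is the typed
gap between the face programme and the deciding crux. [cite: LottiRomani1983, Prop. 4.1] [cite: Strassen1988, Thm. 3.8] -/
theorem allCusps_of_allRates
    (h : ∀ θ : ℝ, 0 ≤ θ → ∃ ρ C : ℝ, θ < ρ ∧ ∀ k : ℕ, 1 ≤ k → omegaRect K 1 k 1 - (k + 1) ≤ C * (k : ℝ) ^ (-ρ))
    {δ : ℝ} (hδ : 0 < δ) {κ : ℝ} (hκ : 0 < κ) :
    ∃ u₀ : ℝ, ∀ F : SpectralMap K, IsUniversalSpectralPoint K F → specMMPoint K F 2 < 1 →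
      u₀ ≤ Real.log (specMMPoint K F 1 / (1 - specMMPoint K F 2)) →
        1 - specMMPoint K F 2 ≤ specMMPoint K F 1 ^ (1 + δ) →
          (specMMPoint K F 0 + specMMPoint K F 1 + specMMPoint K F 2 - 2) *
              Real.log (specMMPoint K F 1 / (1 - specMMPoint K F 2)) ≤ κ * specMMPoint K F 1 :=
  cuspModulus_of_rateBeyond (one_div_pos.2 hδ) (h (1 / δ) (by positivity)) (by rw [one_div_one_div]) hκ

end Summit.MatrixMultiplication.MatrixMultiplication.Theorems.SaturationLadderCuspModulus

end
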